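import Summits.HubbardSuperconductivity.HubbardSuperconductivity.Theorems.DeformationLadderApproximatingHamiltonianGCSourcedBoxes
import Summits.HubbardSuperconductivity.HubbardSuperconductivity.Theorems.ThermalWedgeTwApproximatingHamiltonianLocality

/-!
# Route `DeformationLadder`, item `ApproximatingHamiltonianGC` (stmt-HubbardSuperconductivity-1895):
# the `d`-wave-sourced Hubbard torus as a pair-sourced Hamiltonian; torus weight versus box weight

Support file (`--supports stmt-HubbardSuperconductivity-1895`), continuing `…SourcedBoxes.lean`.

* `dlst_dWaveSourceTorus_eq_sourced`: `dWaveSourceTorus L U μ h = hamiltonianWith (fermionTorusGraph 2 L) 1 U μ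
  − Σ_{p,q} W_T(p,q)(b_{pq} + b_{pq}ᴴ)` with the TORUS WEIGHT
  `W_T(p,q) = h Σ_{e ∈ {0,±e₁,±e₂}} [q = p + e on (ℤ/Lℤ)²] d(e)/√2` (re-indexing the pair field
  `Δ_d = Σ_x Σ_e (d(e)/√2) b_{x,x+e}` through `FermionTorus.equivTorusSite`);
* integer coordinates of torus sites (`[0,L)`-representatives): no wrap-around ⇒ no reduction
  (`dlst_coord_ofTorusSite_add`);
* `dlst_card_weight_mismatch_le`: the torus weight and the BOX WEIGHT `W_B(p,q) = h·d(coord q − coord p)/√2`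
  differ on at most `20L` ordered pairs — a mismatch forces `q = p + e` for a step `e` wrapping `p` around a
  seam, and such `(p,e)` exit through the `≤ 4L` boundary sites (`dlst_card_boundary_le`), `5` steps each.

Ruelle, *Statistical Mechanics: Rigorous Results* (1969) §2 (boundary conditions). No definitions are introduced.
-/

set_option linter.dupNamespace false

noncomputable section

namespace Summit.HubbardSuperconductivity.HubbardSuperconductivity.Theorems

open Matrix Finset Literature.MathematicalPhysics.QuantumLattice
open Literature.MathematicalPhysics.QuantumLattice.ThermodynamicLimit
open Literature.Barriers.HubbardSuperconductivity (bondPair bondPair_conjTranspose norm_bondPair_le_two)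
open scoped ComplexOrder Matrix.Norms.L2Operator

/-! ### The `d`-wave-sourced torus as a pair-sourced Hubbard Hamiltonian; torus versus box -/

section Torus

open Literature.Probability.LatticeModels Filter Topology
open Literature.Barriers.HubbardSuperconductivity (localPair_eq_sum_bondPair apply_mem_insert_unitSteps)

variable (L : ℕ) [NeZero L]

/-- **The torus source as a pair weight.** For any form factor `g`,
`h(Δ_g + Δ_gᴴ) = Σ_{p,q} W(p,q)(b_{pq} + b_{pq}ᴴ)` with
`W(p,q) = h Σ_{e ∈ {0,±e₁,±e₂}} [q = p + e on the torus] g(e)/√2` (re-indexing the sites of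
`Δ_g = Σ_x Σ_e (g e/√2) b_{x,x+e}` through `FermionTorus.equivTorusSite`). [folklore] -/
theorem dlst_smul_pairField_add_conjTranspose_eq (g : Site 2 → ℝ) (h : ℝ) :
    (h : ℂ) • (pairField g L + (pairField g L)ᴴ) =
      ∑ p : FermionTorus 2 L, ∑ q : FermionTorus 2 L,
        ((h * ∑ e ∈ insert (0 : Site 2) unitSteps,
            (if FermionTorus.ofTorusSite (FermionTorus.toTorusSite p + Torus.proj L e) = q
              then g e / Real.sqrt 2 else 0) : ℝ) : ℂ) • (bondPair p q + (bondPair p q)ᴴ) := by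
  -- the source as a double sum over sites and steps
  have hsrc : pairField g L + (pairField g L)ᴴ = ∑ x : TorusSite 2 L,
      ∑ e ∈ insert (0 : Site 2) unitSteps, ((g e / Real.sqrt 2 : ℝ) : ℂ) •
        (bondPair (FermionTorus.ofTorusSite x) (FermionTorus.ofTorusSite (x + Torus.proj L e)) +
          (bondPair (FermionTorus.ofTorusSite x) (FermionTorus.ofTorusSite (x + Torus.proj L e)))ᴴ) := by
    rw [pairField]
    simp only [localPair_eq_sum_bondPair, conjTranspose_sum, conjTranspose_smul, Complex.star_def,
      Complex.conj_ofReal, ← Finset.sum_add_distrib, smul_add]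
  rw [hsrc, Finset.smul_sum, ← Equiv.sum_comp FermionTorus.equivTorusSite.symm]
  refine Finset.sum_congr rfl fun x _ => ?_
  have hx : FermionTorus.equivTorusSite.symm x = FermionTorus.ofTorusSite (L := L) x := rfl
  rw [hx, FermionTorus.toTorusSite_ofTorusSite, Finset.smul_sum]
  symm
  calc ∑ q : FermionTorus 2 L, ((h * ∑ e ∈ insert (0 : Site 2) unitSteps,
          (if FermionTorus.ofTorusSite (x + Torus.proj L e) = q then g e / Real.sqrt 2 else 0) : ℝ) :
            ℂ) • (bondPair (FermionTorus.ofTorusSite x) q + (bondPair (FermionTorus.ofTorusSite x) q)ᴴ)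
      = ∑ q : FermionTorus 2 L, ∑ e ∈ insert (0 : Site 2) unitSteps,
          (if FermionTorus.ofTorusSite (x + Torus.proj L e) = q then
            (h : ℂ) • (((g e / Real.sqrt 2 : ℝ) : ℂ) •
              (bondPair (FermionTorus.ofTorusSite x) q + (bondPair (FermionTorus.ofTorusSite x) q)ᴴ))
            else 0) := by
        refine Finset.sum_congr rfl fun q _ => ?_
        rw [Complex.ofReal_mul, Complex.ofReal_sum, Finset.mul_sum, Finset.sum_smul]
        refine Finset.sum_congr rfl fun e _ => ?_
        split_ifs
        · rw [smul_smul]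
        · rw [Complex.ofReal_zero, mul_zero, zero_smul]
    _ = ∑ e ∈ insert (0 : Site 2) unitSteps, (h : ℂ) • (((g e / Real.sqrt 2 : ℝ) : ℂ) •
          (bondPair (FermionTorus.ofTorusSite x) (FermionTorus.ofTorusSite (x + Torus.proj L e)) +
            (bondPair (FermionTorus.ofTorusSite x)
              (FermionTorus.ofTorusSite (x + Torus.proj L e)))ᴴ)) := by
        rw [Finset.sum_comm]
        refine Finset.sum_congr rfl fun e _ => ?_
        rw [Finset.sum_ite_eq]
        simp

/-- **The `d`-wave-sourced Hubbard torus is a pair-sourced Hubbard Hamiltonian** on the graph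
`fermionTorusGraph 2 L` (hopping `t = 1`). [folklore] -/
theorem dlst_dWaveSourceTorus_eq_sourced (U μ h : ℝ) :
    dWaveSourceTorus L U μ h = hamiltonianWith (fermionTorusGraph 2 L) 1 U μ -
      ∑ p : FermionTorus 2 L, ∑ q : FermionTorus 2 L,
        ((h * ∑ e ∈ insert (0 : Site 2) unitSteps,
            (if FermionTorus.ofTorusSite (FermionTorus.toTorusSite p + Torus.proj L e) = q
              then dWaveFormFactor e / Real.sqrt 2 else 0) : ℝ) : ℂ) •
          (bondPair p q + (bondPair p q)ᴴ) := by
  rw [dWaveSourceTorus_eq, dlst_smul_pairField_add_conjTranspose_eq]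
  rfl

/-! #### Integer coordinates of torus sites -/

omit [NeZero L] in
/-- Integer coordinates of a torus site lie in `[0, L)`. [folklore] -/
theorem dlst_coord_mem (q : FermionTorus 2 L) (i : Fin 2) :
    0 ≤ ((ofLex q i : ℕ) : ℤ) ∧ ((ofLex q i : ℕ) : ℤ) < L := by
  have := (ofLex q i).isLt
  omega

omit [NeZero L] in
/-- Torus sites are determined by their integer coordinates. [folklore] -/
theorem dlst_eq_of_coord_eq {p q : FermionTorus 2 L}
    (hpq : (fun i : Fin 2 => ((ofLex p i : ℕ) : ℤ)) = fun i => ((ofLex q i : ℕ) : ℤ)) : p = q := by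
  refine ofLex.injective (funext fun i => Fin.ext ?_)
  have := congrFun hpq i
  exact_mod_cast this

/-- The integer coordinates of `ofTorusSite x` are the canonical representatives `(x i).val`.
[folklore] -/
theorem dlst_coord_ofTorusSite (x : TorusSite 2 L) :
    (fun i : Fin 2 => ((ofLex (FermionTorus.ofTorusSite x) i : ℕ) : ℤ)) = fun i => ((x i).val : ℤ) := by
  funext i
  rw [FermionTorus.ofLex_ofTorusSite_apply]

/-- **No wrap-around, no reduction**: if every coordinate of `x + e` stays in `[0, L)`, the
integer coordinates of the torus site `x + e` are those of `x` plus `e`. [folklore] -/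
theorem dlst_coord_ofTorusSite_add (x : TorusSite 2 L) (e : Site 2)
    (hnw : ∀ i : Fin 2, 0 ≤ ((x i).val : ℤ) + e i ∧ ((x i).val : ℤ) + e i < L) :
    (fun i : Fin 2 => ((ofLex (FermionTorus.ofTorusSite (x + Torus.proj L e)) i : ℕ) : ℤ)) =
      (fun i => ((x i).val : ℤ)) + e := by
  funext i
  rw [FermionTorus.ofLex_ofTorusSite_apply, Pi.add_apply, Pi.add_apply, Torus.proj_apply]
  obtain ⟨h0, hL⟩ := hnw i
  have key : ∀ (n : ℕ) (a : ℤ), 0 ≤ (n : ℤ) + a → (n : ℤ) + a < L →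
      ((((n : ZMod L) + (a : ZMod L)).val : ℕ) : ℤ) = n + a := by
    intro n a h0' hL'
    rw [show ((n : ZMod L) + (a : ZMod L)) = (((n : ℤ) + a : ℤ) : ZMod L) by
      rw [Int.cast_add, Int.cast_natCast], ZMod.val_intCast, Int.emod_eq_of_lt h0' hL']
  have hx : (((x i).val : ℕ) : ZMod L) = x i := ZMod.natCast_zmod_val (x i)
  calc ((((x i + ((e i : ℤ) : ZMod L)).val : ℕ)) : ℤ)
      = (((((((x i).val : ℕ) : ZMod L) + ((e i : ℤ) : ZMod L)).val : ℕ)) : ℤ) := by rw [hx]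
    _ = ((x i).val : ℤ) + e i := key _ _ h0 hL

/-! #### Torus weight versus box weight -/

omit [NeZero L] in
/-- The box weight through the steps: `d(v)/√2 = Σ_{e ∈ {0,±e₁,±e₂}} [v = e] d(e)/√2` (the
`d`-wave form factor is supported on the unit steps). [folklore] -/
theorem dlst_dWave_eq_sum_ite (v : Site 2) :
    dWaveFormFactor v / Real.sqrt 2 =
      ∑ e ∈ insert (0 : Site 2) unitSteps, if v = e then dWaveFormFactor e / Real.sqrt 2 else 0 := by
  rw [Finset.sum_ite_eq]
  split_ifs with hv
  · rfl
  · have h0 : dWaveFormFactor v = 0 := by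
      by_contra hne
      apply hv
      rcases dlsb_eq_unitStep_of_dWaveFormFactor_ne_zero hne with h | h | h | h <;>
        simp [unitSteps, h]
    rw [h0, zero_div]

/-- A step `e ∈ {0, ±e₁, ±e₂}` that wraps a site `x` around the torus exits through a boundary
row or column of the fundamental domain: some coordinate of `x` is `0` or `L - 1`. [folklore] -/
theorem dlst_boundary_of_wrap {x : TorusSite 2 L} {e : Site 2}
    (he : e ∈ insert (0 : Site 2) unitSteps)
    (hw : ¬ ∀ i : Fin 2, 0 ≤ ((x i).val : ℤ) + e i ∧ ((x i).val : ℤ) + e i < L) :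
    ∃ i : Fin 2, (x i).val = 0 ∨ (x i).val + 1 = L := by
  push Not at hw
  obtain ⟨i, hi⟩ := hw
  refine ⟨i, ?_⟩
  have hlt := ZMod.val_lt (x i)
  rcases apply_mem_insert_unitSteps he i with h | h | h <;> rw [h] at hi <;> omega

/-- **At most `4L` boundary sites**: the sites of `(ℤ/Lℤ)²` with a coordinate equal to `0` or
`L - 1` number at most `4L`. [folklore] -/
theorem dlst_card_boundary_le :
    #{x : TorusSite 2 L | ∃ i : Fin 2, (x i).val = 0 ∨ (x i).val + 1 = L} ≤ 4 * L := by
  have hslice : ∀ (i j : Fin 2), i ≠ j → ∀ (P : ZMod L → Prop) [DecidablePred P],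
      (∀ a b : ZMod L, P a → P b → a = b) → #{x : TorusSite 2 L | P (x i)} ≤ L := by
    intro i j hij P _ hP
    calc #{x : TorusSite 2 L | P (x i)} ≤ (Finset.univ : Finset (ZMod L)).card :=
          Finset.card_le_card_of_injOn (fun x => x j) (fun _ _ => Finset.mem_univ _) ?_
      _ = L := by rw [Finset.card_univ, ZMod.card]
    intro x hx y hy hxy
    rw [Finset.mem_coe, Finset.mem_filter] at hx hy
    funext k
    by_cases hk : k = i
    · subst hk; exact hP _ _ hx.2 hy.2
    · have hkj : k = j := by
        fin_cases i <;> fin_cases j <;> fin_cases k <;> simp_all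
      subst hkj; exact hxy
  have h00 := hslice 0 1 (by decide) (fun a => a.val = 0) fun a b ha hb =>
    ZMod.val_injective L (ha.trans hb.symm)
  have h01 := hslice 0 1 (by decide) (fun a => a.val + 1 = L) fun a b ha hb =>
    ZMod.val_injective L (by omega)
  have h10 := hslice 1 0 (by decide) (fun a => a.val = 0) fun a b ha hb =>
    ZMod.val_injective L (ha.trans hb.symm)
  have h11 := hslice 1 0 (by decide) (fun a => a.val + 1 = L) fun a b ha hb =>
    ZMod.val_injective L (by omega)
  calc #{x : TorusSite 2 L | ∃ i : Fin 2, (x i).val = 0 ∨ (x i).val + 1 = L}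
      ≤ #((Finset.univ.filter fun x : TorusSite 2 L => (x 0).val = 0) ∪
          (Finset.univ.filter fun x : TorusSite 2 L => (x 0).val + 1 = L) ∪
          ((Finset.univ.filter fun x : TorusSite 2 L => (x 1).val = 0) ∪
            (Finset.univ.filter fun x : TorusSite 2 L => (x 1).val + 1 = L))) := by
        refine Finset.card_le_card fun x hx => ?_
        rw [Finset.mem_filter] at hx
        obtain ⟨i, hi⟩ := hx.2
        simp only [Finset.mem_union, Finset.mem_filter, Finset.mem_univ, true_and]
        fin_cases i
        · exact Or.inl hi
        · exact Or.inr hi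
    _ ≤ L + L + (L + L) := by
        refine (Finset.card_union_le _ _).trans (add_le_add ((Finset.card_union_le _ _).trans
          (add_le_add h00 h01)) ((Finset.card_union_le _ _).trans (add_le_add h10 h11)))
    _ = 4 * L := by ring

/-- **The torus weight and the box weight differ on at most `20L` ordered pairs.** If the
`d`-wave torus weight `W_T(p,q) = h Σ_e [q = p + e on the torus] d(e)/√2` and the box weight
`W_B(p,q) = h d(coord q − coord p)/√2` differ at `(p,q)`, then `q = p + e` for a step `e` that
wraps `p` around a seam (without wrap-around the two conditions `q = p + e (mod L)` and
`coord q − coord p = e` agree, and with wrap-around the second is impossible); such `(p, e)`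
number at most `4L · 5`. [folklore] -/
theorem dlst_card_weight_mismatch_le (h : ℝ) :
    #{pq : FermionTorus 2 L × FermionTorus 2 L |
        h * (∑ e ∈ insert (0 : Site 2) unitSteps,
          (if FermionTorus.ofTorusSite (FermionTorus.toTorusSite pq.1 + Torus.proj L e) = pq.2
            then dWaveFormFactor e / Real.sqrt 2 else 0)) ≠
        h * (dWaveFormFactor ((fun i : Fin 2 => ((ofLex pq.2 i : ℕ) : ℤ)) -
          fun i : Fin 2 => ((ofLex pq.1 i : ℕ) : ℤ)) / Real.sqrt 2)} ≤ 20 * L := by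
  -- the wrapping (site, step) pairs
  set Wr : Finset (TorusSite 2 L × Site 2) :=
    (Finset.univ ×ˢ insert (0 : Site 2) unitSteps).filter fun xe =>
      ¬ ∀ i : Fin 2, 0 ≤ ((xe.1 i).val : ℤ) + xe.2 i ∧ ((xe.1 i).val : ℤ) + xe.2 i < L with hWr
  have hWrcard : Wr.card ≤ 20 * L := by
    calc Wr.card ≤ ((Finset.univ.filter fun x : TorusSite 2 L =>
          ∃ i : Fin 2, (x i).val = 0 ∨ (x i).val + 1 = L) ×ˢ insert (0 : Site 2) unitSteps).card := by
          refine Finset.card_le_card fun xe hxe => ?_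
          rw [hWr, Finset.mem_filter, Finset.mem_product] at hxe
          rw [Finset.mem_product, Finset.mem_filter]
          exact ⟨⟨Finset.mem_univ _, dlst_boundary_of_wrap L hxe.1.2 hxe.2⟩, hxe.1.2⟩
      _ ≤ 4 * L * 5 := by
          rw [Finset.card_product]
          exact Nat.mul_le_mul (dlst_card_boundary_le L) twAhm_card_steps_le
      _ = 20 * L := by ring
  -- mismatched pairs are images `(x, x + e)` of wrapping pairs
  refine le_trans (Finset.card_le_card (t := Wr.image fun xe =>
    (FermionTorus.ofTorusSite xe.1, FermionTorus.ofTorusSite (xe.1 + Torus.proj L xe.2))) ?_)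
    (Finset.card_image_le.trans hWrcard)
  rintro ⟨p, q⟩ hpq
  rw [Finset.mem_filter] at hpq
  obtain ⟨-, hne⟩ := hpq
  simp only at hne
  set x : TorusSite 2 L := FermionTorus.toTorusSite p with hxdef
  have hp : FermionTorus.ofTorusSite x = p := FermionTorus.ofTorusSite_toTorusSite p
  have hιp : (fun i : Fin 2 => ((ofLex p i : ℕ) : ℤ)) = fun i => ((x i).val : ℤ) := by
    have := dlst_coord_ofTorusSite L x
    rwa [hp] at this
  -- the two weights as sums over the steps differ in some step `e`
  have hsum : (∑ e ∈ insert (0 : Site 2) unitSteps,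
      (if FermionTorus.ofTorusSite (x + Torus.proj L e) = q then dWaveFormFactor e / Real.sqrt 2
        else 0)) ≠
      ∑ e ∈ insert (0 : Site 2) unitSteps,
        (if ((fun i : Fin 2 => ((ofLex q i : ℕ) : ℤ)) - fun i : Fin 2 => ((ofLex p i : ℕ) : ℤ)) = e
          then dWaveFormFactor e / Real.sqrt 2 else 0) := by
    intro heq
    apply hne
    rw [dlst_dWave_eq_sum_ite, heq]
  obtain ⟨e, heS, hediff⟩ : ∃ e ∈ insert (0 : Site 2) unitSteps,
      (if FermionTorus.ofTorusSite (x + Torus.proj L e) = q then dWaveFormFactor e / Real.sqrt 2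
        else 0) ≠
      (if ((fun i : Fin 2 => ((ofLex q i : ℕ) : ℤ)) - fun i : Fin 2 => ((ofLex p i : ℕ) : ℤ)) = e
        then dWaveFormFactor e / Real.sqrt 2 else 0) := by
    by_contra hall
    push Not at hall
    exact hsum (Finset.sum_congr rfl hall)
  by_cases hw : ∀ i : Fin 2, 0 ≤ ((x i).val : ℤ) + e i ∧ ((x i).val : ℤ) + e i < L
  · -- no wrap-around: the two conditions agree, contradiction
    exfalso
    apply hediff
    have hco := dlst_coord_ofTorusSite_add L x e hw
    have hiff : FermionTorus.ofTorusSite (x + Torus.proj L e) = q ↔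
        ((fun i : Fin 2 => ((ofLex q i : ℕ) : ℤ)) - fun i : Fin 2 => ((ofLex p i : ℕ) : ℤ)) = e := by
      constructor
      · intro h1
        rw [← h1, hco, hιp, add_sub_cancel_left]
      · intro h2
        symm
        apply dlst_eq_of_coord_eq L
        rw [hco, ← hιp]
        exact (sub_eq_iff_eq_add'.1 h2)
    exact if_congr hiff rfl rfl
  · -- wrap-around: the box condition fails, so the torus condition holds
    have hv : ¬ (((fun i : Fin 2 => ((ofLex q i : ℕ) : ℤ)) -
        fun i : Fin 2 => ((ofLex p i : ℕ) : ℤ)) = e) := by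
      intro h2
      apply hw
      intro i
      have h2i := congrFun h2 i
      have hpi := congrFun hιp i
      simp only [Pi.sub_apply] at h2i hpi
      have hqi := dlst_coord_mem L q i
      omega
    have hc1 : FermionTorus.ofTorusSite (x + Torus.proj L e) = q := by
      by_contra hc1
      exact hediff (by rw [if_neg hc1, if_neg hv])
    refine Finset.mem_image.2 ⟨(x, e), ?_, ?_⟩
    · rw [hWr, Finset.mem_filter, Finset.mem_product]
      exact ⟨⟨Finset.mem_univ _, heS⟩, hw⟩
    · simp only [hp, hc1]

end Torus

end Summit.HubbardSuperconductivity.HubbardSuperconductivity.Theorems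

end
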